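import Literature.NumberTheory.GaloisCohomology.KatoCohomologyDifferentialForms
import HarnessLib

/-!
# Stub `stub_bkAssemble` of crux stmt-ResolutionOfSingularities-17142
# (`WildPurity.PurityTransfer`, line `birth`, lead c1 skeleton rev L4)

Assembly of the Bloch–Kato presentation `BlochKato1986_symbolicPresentation`
(`KatoCohomologySymbolic p K n ≃+ KatoCohomologyDeRham p K n`, `[a, b} ↦ class of
a · dlog b₀ ∧ ⋯ ∧ dlog b_{n-1}`) from its four ingredients, taken as hypotheses:

* `hspan` — the logarithmic forms `dlogForm K b` span `Ωⁿ_K = ⋀ⁿ_K Ω[K⁄ℤ]` over `K`;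
* `hfwd`  — a forward additive map `φ` with `φ [a, b} = formClass p a b`;
* `hbwd`  — an additive map `ψ₀` on FORMS with `ψ₀ (a • dlogForm K b) = [a, b}`;
* `hdesc` — such a `ψ₀` kills the exact and the Artin–Schreier forms.

Pure algebra: `ψ₀` descends to `ψ` on the quotient `KatoCohomologyDeRham p K n`
(`QuotientAddGroup.lift`); `ψ ∘ φ = id` on symbols (`KatoCohomologySymbolic.hom_ext`), and
`φ ∘ ψ = id` because additive maps out of `Ωⁿ_K` agreeing on all `c • dlogForm K b` agree
(`hspan`, `Submodule.span_induction`) and maps out of the quotient are determined by their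
composite with the projection (`QuotientAddGroup.addMonoidHom_ext`).
-/

set_option linter.dupNamespace false

noncomputable section

universe u

open Literature.NumberTheory.GaloisCohomology

namespace Summit.ResolutionOfSingularities.ResolutionOfSingularities.Theorems.WildPurityPurityTransfer

/-- Two additive maps out of `Ωⁿ_K = ⋀ⁿ_K Ω[K⁄ℤ]` that agree on every `c • dlogForm K b` are equal,
provided the logarithmic forms `dlogForm K b` span `Ωⁿ_K` over `K`. [folklore] -/
theorem bkAssemble_addMonoidHom_ext {K : Type u} [CommRing K] {n : ℕ} {A : Type*} [AddCommGroup A]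
    (hspan : Submodule.span K (Set.range (dlogForm K (n := n))) = ⊤)
    {F G : (⋀[K]^n (Ω[K⁄ℤ])) →+ A}
    (h : ∀ (c : K) (b : Fin n → Kˣ), F (c • dlogForm K b) = G (c • dlogForm K b)) : F = G := by
  ext ω
  have hω : ω ∈ Submodule.span K (Set.range (dlogForm K (n := n))) := by
    rw [hspan]; exact Submodule.mem_top
  suffices key : ∀ c : K, F (c • ω) = G (c • ω) by simpa using key 1
  induction hω using Submodule.span_induction with
  | mem x hx =>
    obtain ⟨b, rfl⟩ := hx
    exact fun c => h c b
  | zero => intro c; simp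
  | add x y _ _ hx hy => intro c; simp [smul_add, hx c, hy c]
  | smul a x _ hx => intro c; rw [smul_smul]; exact hx (c * a)

/-- **Assembly of the Bloch–Kato presentation** from its four ingredients: the forward map `φ`
(`hfwd`) and the descent `ψ` of `ψ₀` (`hbwd`, `hdesc`) to
`KatoCohomologyDeRham p K n = Ωⁿ_K ⧸ (dΩⁿ⁻¹_K ⊔ AS)` (`QuotientAddGroup.lift`) are mutually inverse —
on symbols by `KatoCohomologySymbolic.hom_ext`, on form classes because the `a • dlogForm K b` span
`Ωⁿ_K` (`hspan`). [cite: BlochKato1986, Lemma (4.2)] -/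
theorem stub_bkAssemble
    (hspan : ∀ (K : Type u) [Field K] (m : ℕ), Submodule.span K (Set.range (dlogForm K (n := m))) = ⊤)
    (hfwd : ∀ (p : ℕ) [Fact p.Prime] (K : Type u) [Field K] [CharP K p] (n : ℕ),
      ∃ φ : KatoCohomologySymbolic p K n →+ KatoCohomologyDeRham p K n,
        ∀ (a : K) (b : Fin n → Kˣ), φ (KatoCohomologySymbolic.symbol p a b) = formClass p a b)
    (hbwd : ∀ (p : ℕ) [Fact p.Prime] (K : Type u) [Field K] [CharP K p] (n : ℕ),
      ∃ ψ₀ : (⋀[K]^n (Ω[K⁄ℤ])) →+ KatoCohomologySymbolic p K n,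
        ∀ (a : K) (b : Fin n → Kˣ), ψ₀ (a • dlogForm K b) = KatoCohomologySymbolic.symbol p a b)
    (hdesc : ∀ (p : ℕ) [Fact p.Prime] (K : Type u) [Field K] [CharP K p] (n : ℕ),
      (∀ m : ℕ, Submodule.span K (Set.range (dlogForm K (n := m))) = ⊤) →
      ∀ (ψ₀ : (⋀[K]^n (Ω[K⁄ℤ])) →+ KatoCohomologySymbolic p K n),
        (∀ (a : K) (b : Fin n → Kˣ), ψ₀ (a • dlogForm K b) = KatoCohomologySymbolic.symbol p a b) →
        ∀ (ω : ⋀[K]^n (Ω[K⁄ℤ])), ω ∈ exactForms K n ⊔ artinSchreierForms K p n → ψ₀ ω = 0) :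
    BlochKato1986_symbolicPresentation.{u} := by
  intro p _ K _ _ n
  obtain ⟨φ, hφ⟩ := hfwd p K n
  obtain ⟨ψ₀, hψ₀⟩ := hbwd p K n
  have hker : exactForms K n ⊔ artinSchreierForms K p n ≤ ψ₀.ker :=
    fun ω hω => (AddMonoidHom.mem_ker).2 (hdesc p K n (hspan K) ψ₀ hψ₀ ω hω)
  let ψ : KatoCohomologyDeRham p K n →+ KatoCohomologySymbolic p K n :=
    QuotientAddGroup.lift (exactForms K n ⊔ artinSchreierForms K p n) ψ₀ hker
  have hψ : ∀ (a : K) (b : Fin n → Kˣ), ψ (formClass p a b) = KatoCohomologySymbolic.symbol p a b :=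
    fun a b => by
      show QuotientAddGroup.lift _ ψ₀ hker (QuotientAddGroup.mk (a • dlogForm K b)) = _
      rw [QuotientAddGroup.lift_mk, hψ₀]
  have h₁ : ψ.comp φ = AddMonoidHom.id _ :=
    KatoCohomologySymbolic.hom_ext p fun a b => by
      simp only [AddMonoidHom.comp_apply, AddMonoidHom.id_apply, hφ, hψ]
  have h₂ : φ.comp ψ = AddMonoidHom.id _ := by
    refine QuotientAddGroup.addMonoidHom_ext _ (bkAssemble_addMonoidHom_ext (hspan K n) ?_)
    intro c b
    simp only [AddMonoidHom.comp_apply, AddMonoidHom.id_apply, QuotientAddGroup.mk'_apply]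
    have : (QuotientAddGroup.mk (c • dlogForm K b) : KatoCohomologyDeRham p K n) = formClass p c b :=
      rfl
    rw [this, hψ, hφ]
  exact ⟨φ.toAddEquiv ψ h₁ h₂, hφ⟩

end Summit.ResolutionOfSingularities.ResolutionOfSingularities.Theorems.WildPurityPurityTransfer

end
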